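import Summits.QuantumFields.GaugeBoot.TiltedLinkRPHolonomy
import HarnessLib

/-!
# Link (mid-plane) reflections on a periodic lattice: splitting the crossing links (gauge-boot, L3(υ) part 4)

HONEST FRAMING (cell `pub-gaugeboot`, page 1 of every file): the venture produces certified bounds
on lattice expectations at stated coupling, gauge group, dimension and torus size; NOT a mass gap,
NOT a continuum limit, NOT a string tension; NOT Yang–Mills-summit-bearing (barriers
`FixedCouplingUltralocality`, `PerturbativeInvisibility`).

Continuation of `TiltedLinkRPHolonomy.lean`: the Osterwalder–Seiler treatment of the CROSSING
plaquettes of the mid-plane reflection `θ x = σ x + e k` of a site frame `IsSiteFrame e k σ Q h`,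
ported verbatim from the cubic-torus proof
`Literature.MathematicalPhysics.QuantumFieldTheory.ConstructiveQFTWave0Proofs` (Osterwalder–Seiler
1978 §2; Seiler LNP 159 Ch. 2; no gauge fixing):

* the blocks `midPosBlock` (`P`, positive links) and `midCrossBlock` (`C`, crossing links);
* the substitution `midTranslate Y U` splitting each crossing link variable — `U_l ↦ U_l Y_l` on the
  lower crossing links (`h = 0 → 1`), `U_l ↦ Y_l U_l` on the upper ones (`h = Q → Q + 1`) — which
  preserves the product Haar measure for every `Y` (left and right invariance of Haar measure on a
  compact group);
* the half plaquette `midHalfPlaq p V` of a crossing plaquette (the path on the positive side of its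
  hyperplane) and **the crossing identity** (`plaqObs_midTranslate_of_isMidCrossPlaq`):
  `Re tr ρ((midTranslate Y U)_p) = ∑_{a,b} Re (τ(ω_p(z))_{ab} conj τ(ω_p(ΘU))_{ab})`, `τ` the
  unitarised representation, `z = splice_C(U, Y)` — so the crossing Boltzmann weight after the
  substitution is a Gram kernel: `∑_ι a_ι(z) conj a_ι(ΘU) = β X(midTranslate Y U)` with the bounded
  measurable coefficient functions `midCoeff` (`√(β/2) τ(ω_p)_{ab}` and their conjugates) depending
  only on the links of `P ∪ C` (`sum_midCoeff_mul_conj`; `β ≥ 0` enters through `√(β/2)`).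

References: K. Osterwalder, E. Seiler, Ann. Phys. 110 (1978) 440, §2; E. Seiler, LNP 159 (1982)
Thm. 2.2.
-/

noncomputable section

open MeasureTheory Complex
open scoped ComplexOrder ComplexConjugate
open Literature.MathematicalPhysics.QuantumFieldTheory (haarProbability LatticeRP.splice
  LatticeRP.splice_apply)
open Literature.RepresentationTheory.CompactGroups

namespace Summit.QuantumFields.GaugeBoot

namespace TiltedRP

variable {A : Type*} [AddCommGroup A] {d : ℕ}

/-! ## The blocks, the substitution, the half plaquette -/

section Defs

variable (e : Fin d → A) (k : Fin d) (Q : ℕ) (h : A →+ ZMod (2 * Q))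

open scoped Classical in
/-- The positive links (block `P` of the mechanism). -/
def midPosBlock [Fintype A] : Finset (Link A d) := Finset.univ.filter fun l => IsMidPosLink e Q h l

open scoped Classical in
/-- The crossing links (block `C` of the mechanism). -/
def midCrossBlock [Fintype A] : Finset (Link A d) :=
  Finset.univ.filter fun l => IsMidCrossLink k Q h l

open scoped Classical in
/-- The substitution splitting the crossing links: `U_l ↦ U_l Y_l` on the lower crossing links,
`U_l ↦ Y_l U_l` on the upper ones; `Y_l` plays the role of the half of the link variable on the
positive side of the hyperplane. -/
def midTranslate {G : Type*} [Group G] (Y U : Config A d G) : Config A d G := fun l =>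
  (if IsMidUpperLink k Q h l then Y l else 1) * U l * (if IsMidLowerLink k Q h l then Y l else 1)

/-- The half plaquette `ω_p(V)` of a crossing plaquette `p` based at `x` (`m` its other direction):
for a lower one (`h x = 0`) the path `x → x + e_k → x + e_k + e_m → x + e_m` (three upper links),
for an upper one (`h x = Q`) the path `x + e_k → x → x + e_m → x + e_m + e_k`. -/
def midHalfPlaq {G : Type*} [Group G] (p : Plaq A d) (V : Config A d G) : G :=
  if (h p.1).val = 0 then V (p.1, k) * V (p.1 + e k, otherDir k p) * (V (p.1 + e (otherDir k p), k))⁻¹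
  else (V (p.1, k))⁻¹ * V (p.1, otherDir k p) * V (p.1 + e (otherDir k p), k)

variable {e k Q h}

/-- Membership in the positive block. -/
theorem mem_midPosBlock [Fintype A] {l : Link A d} : l ∈ midPosBlock e Q h ↔ IsMidPosLink e Q h l := by
  classical
  simp [midPosBlock]

/-- Membership in the crossing block. -/
theorem mem_midCrossBlock [Fintype A] {l : Link A d} :
    l ∈ midCrossBlock k Q h ↔ IsMidCrossLink k Q h l := by
  classical
  simp [midCrossBlock]

/-- The spliced configuration `z = splice_C(U, Y)` on a crossing link: `Y`. -/
theorem splice_apply_of_isMidCrossLink [Fintype A] [DecidableEq A] {G : Type*} (U Y : Config A d G)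
    {l : Link A d}
    (hl : IsMidCrossLink k Q h l) : LatticeRP.splice (midCrossBlock k Q h) (U, Y) l = Y l := by
  rw [LatticeRP.splice_apply, if_pos (mem_midCrossBlock.2 hl)]

/-- The spliced configuration off the crossing links: `U`. -/
theorem splice_apply_of_not_isMidCrossLink [Fintype A] [DecidableEq A] {G : Type*} (U Y : Config A d G)
    {l : Link A d} (hl : ¬ IsMidCrossLink k Q h l) :
    LatticeRP.splice (midCrossBlock k Q h) (U, Y) l = U l := by
  rw [LatticeRP.splice_apply, if_neg (fun h' => hl (mem_midCrossBlock.1 h'))]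

/-- `midTranslate` does not change non-crossing links. -/
theorem midTranslate_apply_of_not_isMidCrossLink {G : Type*} [Group G] (Y U : Config A d G)
    {l : Link A d} (hl : ¬ IsMidCrossLink k Q h l) : midTranslate k Q h Y U l = U l := by
  classical
  have h1 : ¬ IsMidLowerLink k Q h l := fun h' => hl h'.isMidCrossLink
  have h2 : ¬ IsMidUpperLink k Q h l := fun h' => hl h'.isMidCrossLink
  simp only [midTranslate, if_neg h1, if_neg h2, one_mul, mul_one]

/-- `midTranslate` does not change links of direction `≠ k`. -/
theorem midTranslate_apply_of_ne {G : Type*} [Group G] (Y U : Config A d G) {l : Link A d}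
    (hl : l.2 ≠ k) : midTranslate k Q h Y U l = U l :=
  midTranslate_apply_of_not_isMidCrossLink Y U fun h' => hl h'.1

end Defs

namespace IsSiteFrame

variable {e : Fin d → A} {k : Fin d} {σ : A →+ A} {Q : ℕ} {h : A →+ ZMod (2 * Q)}
variable (hF : IsSiteFrame e k σ Q h)
variable {N : ℕ} {G : Type*} [Group G] [TopologicalSpace G] [IsTopologicalGroup G] [CompactSpace G]
  [MeasurableSpace G] [BorelSpace G] [SecondCountableTopology G]
variable (ρ : G →* Matrix (Fin N) (Fin N) ℂ)
include hF

omit [TopologicalSpace G] [IsTopologicalGroup G] [CompactSpace G] [MeasurableSpace G] [BorelSpace G]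
  [SecondCountableTopology G] in
/-- `midTranslate` on a lower crossing link: `U_l ↦ U_l Y_l`. -/
theorem midTranslate_apply_of_isMidLowerLink (Y U : Config A d G) {l : Link A d}
    (hl : IsMidLowerLink k Q h l) : midTranslate k Q h Y U l = U l * Y l := by
  classical
  simp only [midTranslate, if_pos hl, if_neg (IsMidLowerLink.not_isMidUpperLink hF hl), one_mul]

omit [TopologicalSpace G] [IsTopologicalGroup G] [CompactSpace G] [MeasurableSpace G] [BorelSpace G]
  [SecondCountableTopology G] in
/-- `midTranslate` on an upper crossing link: `U_l ↦ Y_l U_l`. -/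
theorem midTranslate_apply_of_isMidUpperLink (Y U : Config A d G) {l : Link A d}
    (hl : IsMidUpperLink k Q h l) : midTranslate k Q h Y U l = Y l * U l := by
  classical
  have h1 : ¬ IsMidLowerLink k Q h l := fun h' => IsMidLowerLink.not_isMidUpperLink hF h' hl
  simp only [midTranslate, if_pos hl, if_neg h1, mul_one]

/-! ## The crossing identity -/

omit [MeasurableSpace G] [BorelSpace G] [SecondCountableTopology G] in
/-- **The crossing identity** (Osterwalder–Seiler 1978 §2). For a crossing plaquette `p`,
`Re tr ρ((midTranslate Y U)_p) = ∑_{a,b} Re (τ(ω_p(z))_{ab} conj τ(ω_p(ΘU))_{ab})`, `τ` the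
unitarised representation and `z = splice_C(U, Y)`: after the substitution the crossing
plaquette is a Gram kernel between the half plaquette of `z` and that of the reflected
configuration. -/
theorem plaqObs_midTranslate_of_isMidCrossPlaq [Fintype A] [DecidableEq A] (hρ : Continuous ρ)
    (U Y : Config A d G)
    {p : Plaq A d} (hp : IsMidCrossPlaq k Q h p) :
    plaqObs ρ e p (midTranslate k Q h Y U) = ∑ a, ∑ b,
      (CompactGroup.unitarize ρ hρ
          (midHalfPlaq e k Q h p (LatticeRP.splice (midCrossBlock k Q h) (U, Y))) a b *
        (starRingEnd ℂ) (CompactGroup.unitarize ρ hρ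
          (midHalfPlaq e k Q h p (configMidReflect e k σ U)) a b)).re := by
  have hQ := hF.two_le
  obtain ⟨hK, hc⟩ := hp
  have hm : otherDir k p ≠ k := otherDir_ne hK
  have hcm : (h (p.1 + e (otherDir k p))).val = (h p.1).val := hF.val_height_add_otherDir hK
  have hΘ1 : configMidReflect e k σ U (p.1, k) = (U (p.1, k))⁻¹ :=
    hF.configMidReflect_of_isMidCrossLink U ⟨rfl, hc⟩
  have hΘ3 : configMidReflect e k σ U (p.1 + e (otherDir k p), k) = (U (p.1 + e (otherDir k p), k))⁻¹ :=
    hF.configMidReflect_of_isMidCrossLink U ⟨rfl, by rw [hcm]; exact hc⟩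
  rw [plaqObs_of_hasDir ρ hρ hK]
  unfold holonomy midHalfPlaq
  rcases hc with hc | hc
  · -- lower crossing plaquette: `h x = 0`
    obtain ⟨hl1, hp2, hl3⟩ := hF.links_of_lower hK hc
    have hΘ2 : configMidReflect e k σ U (p.1 + e k, otherDir k p) = U (p.1, otherDir k p) := by
      rw [configMidReflect_other e k σ U _ hm, hF.midReflect_add_self, hF.map_of_val (Or.inl hc)]
    rw [if_pos hc, if_pos hc, hF.midTranslate_apply_of_isMidLowerLink Y U hl1,
      midTranslate_apply_of_ne Y U (l := (p.1 + e k, otherDir k p)) hm,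
      hF.midTranslate_apply_of_isMidLowerLink Y U hl3,
      midTranslate_apply_of_ne Y U (l := (p.1, otherDir k p)) hm,
      splice_apply_of_isMidCrossLink U Y hl1.isMidCrossLink,
      splice_apply_of_not_isMidCrossLink U Y (l := (p.1 + e k, otherDir k p)) (fun h' => hm h'.1),
      splice_apply_of_isMidCrossLink U Y hl3.isMidCrossLink, hΘ1, hΘ2, hΘ3]
    rw [show U (p.1, k) * Y (p.1, k) * U (p.1 + e k, otherDir k p) *
          (U (p.1 + e (otherDir k p), k) * Y (p.1 + e (otherDir k p), k))⁻¹ *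
          (U (p.1, otherDir k p))⁻¹ =
        U (p.1, k) * ((Y (p.1, k) * U (p.1 + e k, otherDir k p) * (Y (p.1 + e (otherDir k p), k))⁻¹) *
          ((U (p.1, k))⁻¹ * U (p.1, otherDir k p) * ((U (p.1 + e (otherDir k p), k))⁻¹)⁻¹)⁻¹) *
          (U (p.1, k))⁻¹ by group,
      CompactGroup.trace_conj_eq, CompactGroup.re_trace_mul_inv_eq_sum ρ hρ]
  · -- upper crossing plaquette: `h x = Q`
    have hc0 : (h p.1).val ≠ 0 := by omega
    obtain ⟨hu1, hp2, hu3⟩ := hF.links_of_upper hK hc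
    have hΘ4 : configMidReflect e k σ U (p.1, otherDir k p) = U (p.1 + e k, otherDir k p) := by
      rw [configMidReflect_other e k σ U _ hm, hF.midReflect_of_isLayer (hF.isLayer_of_val (Or.inr hc))]
    rw [if_neg hc0, if_neg hc0, hF.midTranslate_apply_of_isMidUpperLink Y U hu1,
      midTranslate_apply_of_ne Y U (l := (p.1 + e k, otherDir k p)) hm,
      hF.midTranslate_apply_of_isMidUpperLink Y U hu3,
      midTranslate_apply_of_ne Y U (l := (p.1, otherDir k p)) hm,
      splice_apply_of_isMidCrossLink U Y hu1.isMidCrossLink,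
      splice_apply_of_not_isMidCrossLink U Y (l := (p.1, otherDir k p)) (fun h' => hm h'.1),
      splice_apply_of_isMidCrossLink U Y hu3.isMidCrossLink, hΘ1, hΘ4, hΘ3]
    rw [show Y (p.1, k) * U (p.1, k) * U (p.1 + e k, otherDir k p) *
          (Y (p.1 + e (otherDir k p), k) * U (p.1 + e (otherDir k p), k))⁻¹ *
          (U (p.1, otherDir k p))⁻¹ =
        Y (p.1, k) * ((((U (p.1, k))⁻¹)⁻¹ * U (p.1 + e k, otherDir k p) *
          (U (p.1 + e (otherDir k p), k))⁻¹) *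
          ((Y (p.1, k))⁻¹ * U (p.1, otherDir k p) * Y (p.1 + e (otherDir k p), k))⁻¹) *
          (Y (p.1, k))⁻¹ by group,
      CompactGroup.trace_conj_eq, CompactGroup.re_trace_mul_inv_eq_sum ρ hρ]
    refine Finset.sum_congr rfl fun a _ => Finset.sum_congr rfl fun b _ => ?_
    simp only [Complex.mul_re, Complex.conj_re, Complex.conj_im]
    ring

/-! ## The Gram coefficients of the crossing plaquettes -/

open scoped Classical in
omit hF in
/-- The coefficient functions `a_ι` of the Gram expansion of the crossing plaquettes: for
`ι = (p, a, b, s)` with `p` crossing, `√(β/2) τ(ω_p(V))_{ab}` (`s = true`) or its conjugate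
(`s = false`); zero if `p` is not crossing. -/
def midCoeff (e : Fin d → A) (k : Fin d) (Q : ℕ) (h : A →+ ZMod (2 * Q)) (hρ : Continuous ρ)
    (β : ℝ) (ι : Plaq A d × Fin N × Fin N × Bool) (V : Config A d G) : ℂ :=
  if IsMidCrossPlaq k Q h ι.1 then
    (Real.sqrt (β / 2) : ℂ) *
      (if ι.2.2.2 then CompactGroup.unitarize ρ hρ (midHalfPlaq e k Q h ι.1 V) ι.2.1 ι.2.2.1
        else (starRingEnd ℂ) (CompactGroup.unitarize ρ hρ (midHalfPlaq e k Q h ι.1 V) ι.2.1 ι.2.2.1))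
  else 0

open scoped Classical in
omit [MeasurableSpace G] [BorelSpace G] [SecondCountableTopology G] in
/-- **The crossing Boltzmann weight after the substitution is a Gram kernel** (`β ≥ 0`):
`∑_ι a_ι(z) conj a_ι(ΘU) = β X(midTranslate Y U)`, `z = splice_C(U, Y)`. -/
theorem sum_midCoeff_mul_conj [Fintype A] [DecidableEq A] (hρ : Continuous ρ) {β : ℝ} (hβ : 0 ≤ β)
    (U Y : Config A d G) :
    ∑ ι, midCoeff ρ e k Q h hρ β ι (LatticeRP.splice (midCrossBlock k Q h) (U, Y)) *
        (starRingEnd ℂ) (midCoeff ρ e k Q h hρ β ι (configMidReflect e k σ U)) =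
      ((β * ∑ p ∈ Finset.univ.filter (IsMidCrossPlaq k Q h),
        plaqObs ρ e p (midTranslate k Q h Y U) : ℝ) : ℂ) := by
  have hs : (Real.sqrt (β / 2) : ℂ) * (Real.sqrt (β / 2) : ℂ) = ((β / 2 : ℝ) : ℂ) := by
    rw [← Complex.ofReal_mul, Real.mul_self_sqrt (by linarith)]
  rw [Finset.mul_sum, Complex.ofReal_sum, Finset.sum_filter, Fintype.sum_prod_type]
  refine Finset.sum_congr rfl fun p _ => ?_
  by_cases hp : IsMidCrossPlaq k Q h p
  · rw [if_pos hp, hF.plaqObs_midTranslate_of_isMidCrossPlaq ρ hρ U Y hp, Finset.mul_sum,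
      Complex.ofReal_sum, Fintype.sum_prod_type]
    refine Finset.sum_congr rfl fun a _ => ?_
    rw [Finset.mul_sum, Complex.ofReal_sum, Fintype.sum_prod_type]
    refine Finset.sum_congr rfl fun b _ => ?_
    rw [Fintype.sum_bool]
    simp only [midCoeff, if_pos hp, ↓reduceIte, Bool.false_eq_true, map_mul, Complex.conj_ofReal,
      Complex.conj_conj]
    set u := CompactGroup.unitarize ρ hρ
      (midHalfPlaq e k Q h p (LatticeRP.splice (midCrossBlock k Q h) (U, Y))) a b
    set w := CompactGroup.unitarize ρ hρ (midHalfPlaq e k Q h p (configMidReflect e k σ U)) a b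
    calc (Real.sqrt (β / 2) : ℂ) * u * ((Real.sqrt (β / 2) : ℂ) * (starRingEnd ℂ) w) +
          (Real.sqrt (β / 2) : ℂ) * (starRingEnd ℂ) u * ((Real.sqrt (β / 2) : ℂ) * w)
        = ((Real.sqrt (β / 2) : ℂ) * (Real.sqrt (β / 2) : ℂ)) *
            (u * (starRingEnd ℂ) w + (starRingEnd ℂ) (u * (starRingEnd ℂ) w)) := by
          simp only [map_mul, Complex.conj_conj]; ring
      _ = ((β * (u * (starRingEnd ℂ) w).re : ℝ) : ℂ) := by
          rw [hs, Complex.add_conj]; push_cast; ring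
  · rw [if_neg hp]
    simp [midCoeff, hp]

omit [MeasurableSpace G] [BorelSpace G] [SecondCountableTopology G] hF in
open scoped Classical in
/-- The coefficient functions are bounded by `√(β/2)` (unitary matrix entries have norm `≤ 1`). -/
theorem norm_midCoeff_le (hρ : Continuous ρ) (β : ℝ) (ι : Plaq A d × Fin N × Fin N × Bool)
    (V : Config A d G) : ‖midCoeff ρ e k Q h hρ β ι V‖ ≤ Real.sqrt (β / 2) := by
  unfold midCoeff
  split_ifs with hp hs
  · rw [norm_mul, Complex.norm_real, Real.norm_eq_abs, abs_of_nonneg (Real.sqrt_nonneg _)]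
    exact mul_le_of_le_one_right (Real.sqrt_nonneg _)
      (CompactGroup.norm_unitarize_apply_le_one ρ hρ _ _ _)
  · rw [norm_mul, Complex.norm_real, Real.norm_eq_abs, abs_of_nonneg (Real.sqrt_nonneg _),
      Complex.norm_conj]
    exact mul_le_of_le_one_right (Real.sqrt_nonneg _)
      (CompactGroup.norm_unitarize_apply_le_one ρ hρ _ _ _)
  · rw [norm_zero]
    exact Real.sqrt_nonneg _

omit [TopologicalSpace G] [IsTopologicalGroup G] [CompactSpace G] [MeasurableSpace G] [BorelSpace G]
  [SecondCountableTopology G] in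
/-- **The half plaquette of a crossing plaquette depends only on the positive and crossing links**
(two crossing links and one positive link). -/
theorem midHalfPlaq_congr {p : Plaq A d} (hp : IsMidCrossPlaq k Q h p) {U V : Config A d G}
    (hUV : ∀ l, IsMidPosLink e Q h l ∨ IsMidCrossLink k Q h l → U l = V l) :
    midHalfPlaq e k Q h p U = midHalfPlaq e k Q h p V := by
  have hQ := hF.two_le
  obtain ⟨hK, hc⟩ := hp
  unfold midHalfPlaq
  rcases hc with hc | hc
  · obtain ⟨hl1, hp2, hl3⟩ := hF.links_of_lower hK hc
    rw [if_pos hc, if_pos hc, hUV _ (Or.inr hl1.isMidCrossLink), hUV _ (Or.inl hp2),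
      hUV _ (Or.inr hl3.isMidCrossLink)]
  · have hc0 : (h p.1).val ≠ 0 := by omega
    obtain ⟨hu1, hp2, hu3⟩ := hF.links_of_upper hK hc
    rw [if_neg hc0, if_neg hc0, hUV _ (Or.inr hu1.isMidCrossLink), hUV _ (Or.inl hp2),
      hUV _ (Or.inr hu3.isMidCrossLink)]

open scoped Classical in
omit [MeasurableSpace G] [BorelSpace G] [SecondCountableTopology G] in
/-- The coefficient functions depend only on the positive and crossing links. -/
theorem midCoeff_congr (hρ : Continuous ρ) (β : ℝ) (ι : Plaq A d × Fin N × Fin N × Bool)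
    {U V : Config A d G} (hUV : ∀ l, IsMidPosLink e Q h l ∨ IsMidCrossLink k Q h l → U l = V l) :
    midCoeff ρ e k Q h hρ β ι U = midCoeff ρ e k Q h hρ β ι V := by
  unfold midCoeff
  by_cases hp : IsMidCrossPlaq k Q h ι.1
  · simp only [if_pos hp, hF.midHalfPlaq_congr hp hUV]
  · simp only [if_neg hp]

omit [CompactSpace G] hF in
/-- The half plaquette is a measurable function of the configuration. -/
theorem measurable_midHalfPlaq (p : Plaq A d) :
    Measurable fun V : Config A d G => midHalfPlaq e k Q h p V := by
  unfold midHalfPlaq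
  by_cases h0 : (h p.1).val = 0
  · simp only [if_pos h0]
    exact ((measurable_pi_apply (p.1, k)).mul (measurable_pi_apply (p.1 + e k, otherDir k p))).mul
      (measurable_pi_apply (p.1 + e (otherDir k p), k)).inv
  · simp only [if_neg h0]
    exact ((measurable_pi_apply (p.1, k)).inv.mul (measurable_pi_apply (p.1, otherDir k p))).mul
      (measurable_pi_apply (p.1 + e (otherDir k p), k))

omit hF in
open scoped Classical in
/-- The coefficient functions are measurable. -/
theorem measurable_midCoeff (hρ : Continuous ρ) (β : ℝ) (ι : Plaq A d × Fin N × Fin N × Bool) :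
    Measurable (midCoeff ρ e k Q h hρ β ι : Config A d G → ℂ) := by
  have hm : ∀ a b, Measurable fun V : Config A d G =>
      CompactGroup.unitarize ρ hρ (midHalfPlaq e k Q h ι.1 V) a b := fun a b =>
    (CompactGroup.continuous_entry (CompactGroup.continuous_unitarize ρ hρ) a b).measurable.comp
      (measurable_midHalfPlaq ι.1)
  unfold midCoeff
  by_cases hp : IsMidCrossPlaq k Q h ι.1
  · simp only [if_pos hp]
    by_cases hs : ι.2.2.2 = true
    · simp only [hs, ↓reduceIte]
      exact (hm _ _).const_mul _
    · simp only [hs, Bool.false_eq_true, ↓reduceIte]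
      exact (Complex.continuous_conj.measurable.comp (hm _ _)).const_mul _
  · simp only [if_neg hp]
    exact measurable_const

/-! ## The substitution preserves the product Haar measure -/

omit [SecondCountableTopology G] hF in
/-- **`midTranslate Y` preserves the product Haar measure** (left and right invariance of the Haar
probability measure of the compact group `G`: right invariance from left invariance and inversion
invariance, `CompactGroup.isInvInvariant_of_isHaarMeasure`). -/
theorem measurePreserving_midTranslate [Fintype A] (Y : Config A d G) :
    MeasurePreserving (midTranslate k Q h Y) (productHaar A d G) (productHaar A d G) := by
  classical
  haveI : IsProbabilityMeasure (haarProbability G) :=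
    CompactGroup.isProbabilityMeasure_haarMeasure_top
  haveI : (haarProbability G).IsHaarMeasure := by
    unfold haarProbability; infer_instance
  haveI : (haarProbability G).IsInvInvariant := by
    unfold haarProbability; exact CompactGroup.isInvInvariant_of_isHaarMeasure _
  haveI : (haarProbability G).IsMulRightInvariant := by
    rw [← Measure.inv_eq_self (haarProbability G)]; infer_instance
  unfold productHaar
  show MeasurePreserving (fun (U : Config A d G) (l : Link A d) =>
    (fun g : G => (if IsMidUpperLink k Q h l then Y l else 1) * g *
      (if IsMidLowerLink k Q h l then Y l else 1)) (U l)) _ _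
  exact measurePreserving_pi _ _ fun l =>
    (measurePreserving_mul_right (haarProbability G) _).comp
      (measurePreserving_mul_left (haarProbability G) _)

end IsSiteFrame

end TiltedRP

end Summit.QuantumFields.GaugeBoot
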